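import Summits.BirchSwinnertonDyer.BirchSwinnertonDyer.Theorems.KatoDescentTamePotSupersingularTameLowerFibreResidualIdentification
import Summits.BirchSwinnertonDyer.BirchSwinnertonDyer.Theorems.KatoDescentTamePotSupersingularTameLowerFibreAdjointBricksFiveCoeffField
import Literature.NumberTheory.GaloisRepresentations.PadicIntermediateFieldIntegers
import HarnessLib

/-!
# Route `KatoDescentTamePotSupersingular` (rung K8-t′, cell `bsd-potss`), open core `TameLowerIntrinsicNonCM`
# (item stmt-BirchSwinnertonDyer-19618) — the RESIDUAL IDENTIFICATION behind the Fouquet-2024 fibre roads, file III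
# (THE NEWFORM DATUM): for an integral ordinary newform datum `Δ : OrdinaryNewformDatum g p ι` whose `q`-expansion
# coefficients are CONGRUENT to the traces of an elliptic curve `W/ℚ` with `ρ̄_{W,p}` onto, some `P₀ ∈ GL₂(𝒪)`
# conjugates `Δ.ρ` to a representation whose reduction covers `GL₂(𝔽_p)` — and hence, at `p = 5`, the desk's
# T1 `LatticeClause Δ` BY KERNEL from {the datum, `K_g/ℚ_5` finite, `Surj W 5`, the trace congruence}
# (a `--supports … --as helper` file; seat `bsd-potss-k8t-c2` generation 18; ROUTE-FREE, NO definitions)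

PARTITION (D-0054, cell bsd-potss): EXCLUDED-DOMAIN non-CM additive `p` · B4 (t′) (`e ∈ {3,4,6}`; cell
`(5; II*, v₅(c₄) = 4)` for the fibre roads), `r_an = 0`, LOWER half L₀ — proves-over-readings (discharges the ONE
displayed binder `hres` of seat g17's file XXII `exists_latticeClause_of_conj_residual_covering_newformDatum`
(p569741) — part (a) of the desk's (C1) reading behind Δ1@5 / T2 `FibreLatticeInput 5` on the cite-level facts
`Fouquet2024.padicValRat_bsd_rank_zero_of_ordinaryFibre{,_ellipticShape}_levelNotOneModP` (p525876) consumed by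
skeleton v7's `FibreRowB` / `FibreRowA`); closes NONE; shrinks-literal none; books nothing; BSD is claimed for no curve.

CONTENT (all PROVED, route-free, no definition, no named fact):
* §1 `exists_quadratic_of_map_eq` — if `P ∈ R[X]` maps under an injective `f` to `X² − aX + b` then
  `P = X² − cX + d` with `f c = a`, `f d = b`;
* §2 `exists_conj_residual_covering_unitBallSubring` — file II's theorem for `S` a subring of an intermediate field
  `L` of `ℚ̄_p/ℚ_p` with carrier the closed unit ball (so `S = 𝒪_L` as a set; e.g. `S = padicCoeffIntegers ι`),
  hypotheses and conclusion in NORM form (transport along the identity isomorphism `S ≃ 𝒪_L =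
  intermediateFieldIntegers p L`, a local ring with maximal ideal the open unit ball);
* §3 **`exists_conj_residual_covering_newformDatum`** — for `Δ : OrdinaryNewformDatum g p ι` (`g ∈ S_k(Γ₀(M))`,
  `M ≠ 0`, weight `k ≡ 2 (mod p − 1)`, `k ≥ 2`, displayed as `(k − 1).toNat = 1 + (p − 1)t`), `W/ℚ` elliptic in
  global minimal form with `ρ̄_{W,p}` onto, and the trace congruence `|ι(a_ℓ(g)) − a_ℓ(W)|_p < 1` at the good primes
  `ℓ ∤ pM` off a finite set: **some `P₀ ∈ GL₂(𝒪)`, `𝒪 = padicCoeffIntegers ι`, has, for every `q ∈ GL₂(𝔽_p)`,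
  a `γ ∈ Γ_ℚ` with `|(P₀ Δ.ρ(γ) P₀⁻¹)_{ij} − q_{ij}|_p < 1`** — EXACTLY the binder `hres` of XXII.  The datum's
  field `charpoly` (Deligne's construction, EPW §3.1: arithmetic-Frobenius characteristic polynomial
  `X² − ι(a_ℓ(g))X + ℓ^{k−1}` at `ℓ ∤ Mp`) supplies the Frobenius data; `ℓ^{k−1} ≡ ℓ (mod p)` is Fermat;
* §4 **END FORM at `p = 5`**: `exists_latticeClause_newformDatum_of_traceCongruent` — T1 `LatticeClause Δ` (σ moreover
  in `Gal(ℚ̄/ℚ(ζ_∞))`) ⟸ {`Δ`, `K_g` a number field (`[FiniteDimensional ℚ (coeffField g)]`), `Surj W 5`, the trace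
  congruence} by kernel (XXII ∘ §3), and `…_of_finiteDimensional_padicCoeffField` with `K/ℚ₅` finite displayed instead.  After this file the (C1) reading of bsd-cited r07 / desk C2 has NO
  named-print residue beyond the EXISTENCE of the datum (Deligne; Wiles 1988 for the ordinary filtration) and
  `K_g` a number field (Shimura 3.48) — both the standing currency of every EPW-type statement in the tree.

HONEST LABEL.  Representation theory over tree theorems; nothing about items 19618/19981 (open: Kato's Conj. 12.10
lower inclusion at an additive potentially supersingular prime), which stay OPEN; nothing is booked; BSD is proved
for no curve.  No definition, no named fact, no `sorry`; axioms `propext`, `Classical.choice`, `Quot.sound`.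

References: [EmertonPollackWeston2006] §3.1 (the datum); [DarmonDiamondTaylor1995] Thm. 2.3, Prop. 2.6 (b)
(PDF pp. 52–54); [DeligneSerreASENS1974] 6.7; [SerreLocalFields1979] II §1–2 (𝒪_L); [Kato2004Asterisque] (12.5.2),
Thm. 14.5; [Fouquet2024CongruencesIMC] Thm. 1.1, Prop. 3.9; [Shimura1971] Thm. 3.48.
-/

set_option autoImplicit false
-- sibling precedent (the `…FibreAdjointBricksFive*` family): the directory name repeats the summit name
set_option linter.dupNamespace false

noncomputable section

open scoped MatrixGroups NumberField Polynomial ModularForm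
open Matrix IsLocalRing Field IsDedekindDomain NumberField Polynomial WeierstrassCurve CongruenceSubgroup
  UpperHalfPlane ModularFormClass
open Literature.NumberTheory.GaloisRepresentations Literature.NumberTheory.EllipticCurves
  Literature.NumberTheory.EllipticCurves.ModularForms Literature.NumberTheory.EllipticCurves.GreenbergSelmer
  Summit.BirchSwinnertonDyer.BirchSwinnertonDyer.Theorems.GL2F5AdjointBricks

namespace Summit.BirchSwinnertonDyer.BirchSwinnertonDyer.Theorems.FibreResidualIdentification

universe u

/-! ## §1 Reading a quadratic off an injective coefficient map -/

/-- If `P ∈ R[X]` maps under an injective ring map `f` to `X² − aX + b`, then `P = X² − cX + d` with `f c = a` and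
`f d = b`. [folklore] -/
theorem exists_quadratic_of_map_eq {R A : Type*} [CommRing R] [CommRing A] (f : R →+* A)
    (hf : Function.Injective f) {P : R[X]} {a b : A} (h : P.map f = X ^ 2 - C a * X + C b) :
    ∃ c d : R, P = X ^ 2 - C c * X + C d ∧ f c = a ∧ f d = b := by
  have h1 : f (P.coeff 1) = -a := by
    have := congrArg (fun Q : A[X] ↦ Q.coeff 1) h
    simpa [Polynomial.coeff_map, Polynomial.coeff_X_pow, Polynomial.coeff_C, Polynomial.coeff_X] using this
  have h0 : f (P.coeff 0) = b := by
    have := congrArg (fun Q : A[X] ↦ Q.coeff 0) h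
    simpa [Polynomial.coeff_map, Polynomial.coeff_X_pow, Polynomial.coeff_C, Polynomial.coeff_X] using this
  refine ⟨-P.coeff 1, P.coeff 0, ?_, by rw [map_neg, h1, neg_neg], h0⟩
  apply Polynomial.map_injective f hf
  rw [h, Polynomial.map_add, Polynomial.map_sub, Polynomial.map_mul, Polynomial.map_pow, Polynomial.map_X,
    Polynomial.map_C, Polynomial.map_C, map_neg, h1, neg_neg, h0]

/-! ## §2 Unit-ball subrings of an intermediate field of `ℚ̄_p/ℚ_p` -/

section unitBall

variable (p : ℕ) [Fact p.Prime] (L : IntermediateField ℚ_[p] (PadicAlgCl p)) (S : Subring L)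
  (hS : ∀ x : L, x ∈ S ↔ ‖(x : PadicAlgCl p)‖ ≤ 1)

include hS in
/-- **File II's residual identification for a unit-ball subring `S` of `L ⊆ ℚ̄_p`** (e.g. `S = padicCoeffIntegers ι`),
in NORM form: `ρ : Γ_ℚ → GL₂(S)` continuous; `W/ℚ` elliptic in global minimal form with `ρ̄_{W,p}` onto; off a finite
set of places, at residue characteristic `ℓ ≠ p` of good reduction, every arithmetic Frobenius has characteristic
polynomial `X² − cX + d` under `ρ` with `|c − a_ℓ(W)| < 1`, `|d − ℓ| < 1`.  Then some `P₀ ∈ GL₂(S)` has, for every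
`q ∈ GL₂(𝔽_p)`, a `γ` with `|(P₀ ρ(γ) P₀⁻¹)_{ij} − q_{ij}| < 1`.
[cite: DarmonDiamondTaylor1995, Thm. 2.3, Prop. 2.6 (b) (PDF pp. 52–54)] [cite: SerreLocalFields1979, Ch. II §1] -/
theorem exists_conj_residual_covering_unitBallSubring
    (ρ : absoluteGaloisGroup ℚ →* GL (Fin 2) S) (hρ : Continuous ρ)
    (W : WeierstrassCurve ℚ) [W.IsElliptic] [W.IsGloballyMinimal] (hsurj : W.HasSurjectiveModNGaloisRep p)
    (T : Set (HeightOneSpectrum (𝓞 ℚ))) (hT : T.Finite)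
    (hfrob : ∀ v ∉ T, ∀ (ℓ : ℕ) [Fact ℓ.Prime], (ℓ : 𝓞 ℚ) ∈ v.asIdeal → ℓ ≠ p → W.HasGoodReductionAtPrime ℓ →
      ∃ c d : S, (∀ 𝔓 ∈ v.primesAbove, ∀ Φ : absoluteGaloisGroup ℚ, IsArithFrobAt (𝓞 ℚ) Φ 𝔓 →
          ((ρ Φ : GL (Fin 2) S) : Matrix (Fin 2) (Fin 2) S).charpoly = X ^ 2 - C c * X + C d) ∧
        ‖((c - ((W.frobeniusTrace ℓ : ℤ) : S) : S) : L)‖ < 1 ∧ ‖((d - (ℓ : S) : S) : L)‖ < 1) :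
    ∃ P₀ : GL (Fin 2) S, ∀ q : GL (Fin 2) (ZMod p), ∃ γ : absoluteGaloisGroup ℚ, ∀ i j,
      ‖(((P₀ * ρ γ * P₀⁻¹).val i j - (((q.val i j).val : ℕ) : S) : S) : L)‖ < 1 := by
  -- the identity isomorphism `e : S ≃ 𝒪_L` and its continuity
  let O := intermediateFieldIntegers p L
  obtain ⟨e, hecoe, he⟩ : ∃ e : S ≃+* O, (∀ x : S, ((e x : O) : L) = (x : L)) ∧ Continuous e := by
    let e : S ≃+* O :=
      { toFun := fun x => ⟨(x : L), (mem_intermediateFieldIntegers_iff _ _).2 ((hS _).1 x.2)⟩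
        invFun := fun y => ⟨(y : L), (hS _).2 ((mem_intermediateFieldIntegers_iff _ _).1 y.2)⟩
        left_inv := fun x => rfl
        right_inv := fun y => rfl
        map_mul' := fun x y => rfl
        map_add' := fun x y => rfl }
    exact ⟨e, fun x => rfl, continuous_subtype_val.subtype_mk _⟩
  -- transport `ρ` along `e`
  let ρO : FramedGaloisRep ℚ O 2 :=
    ⟨(Matrix.GeneralLinearGroup.map e.toRingHom).comp ρ, (he.generalLinearGroup_map).comp hρ⟩
  have hρO : ∀ g, ((ρO g : GL (Fin 2) O) : Matrix (Fin 2) (Fin 2) O) =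
      ((ρ g : GL (Fin 2) S) : Matrix (Fin 2) (Fin 2) S).map e.toRingHom := fun g ↦ rfl
  -- the hypotheses of file II for `𝒪_L`
  have h𝔪 : IsOpen ((maximalIdeal O : Ideal O) : Set O) := by
    have hset : ((maximalIdeal O : Ideal O) : Set O) = {a : O | ‖(a : L)‖ < 1} :=
      Set.ext fun a ↦ intermediateFieldIntegers.mem_maximalIdeal_iff L a
    rw [hset]
    exact isOpen_lt (continuous_norm.comp continuous_subtype_val) continuous_const
  have hp : (p : O) ∈ maximalIdeal O := intermediateFieldIntegers.natCast_mem_maximalIdeal L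
  have hmem : ∀ x : S, e x ∈ maximalIdeal O ↔ ‖(x : L)‖ < 1 := fun x ↦ by
    rw [intermediateFieldIntegers.mem_maximalIdeal_iff, hecoe]
  have hfrobO : ∀ v ∉ T, ∀ (ℓ : ℕ) [Fact ℓ.Prime], (ℓ : 𝓞 ℚ) ∈ v.asIdeal → ℓ ≠ p →
      W.HasGoodReductionAtPrime ℓ →
      ∃ c d : O, ρO.HasFrobCharpolyAt v (X ^ 2 - C c * X + C d) ∧
        c - ((W.frobeniusTrace ℓ : ℤ) : O) ∈ maximalIdeal O ∧ d - (ℓ : O) ∈ maximalIdeal O := by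
    intro v hv ℓ _ hℓv hℓp hgood
    obtain ⟨c, d, hcd, hc, hd⟩ := hfrob v hv ℓ hℓv hℓp hgood
    refine ⟨e c, e d, fun 𝔓 h𝔓 Φ hΦ ↦ ?_, ?_, ?_⟩
    · show ((ρO Φ : GL (Fin 2) O) : Matrix (Fin 2) (Fin 2) O).charpoly = _
      rw [hρO, Matrix.charpoly_map, hcd 𝔓 h𝔓 Φ hΦ]
      simp only [Polynomial.map_add, Polynomial.map_sub, Polynomial.map_mul, Polynomial.map_pow,
        Polynomial.map_X, Polynomial.map_C, RingEquiv.toRingHom_eq_coe, RingHom.coe_coe]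
    · have : e c - ((W.frobeniusTrace ℓ : ℤ) : O) = e (c - ((W.frobeniusTrace ℓ : ℤ) : S)) := by
        rw [map_sub, map_intCast]
      rw [this, hmem]
      exact hc
    · have : e d - (ℓ : O) = e (d - (ℓ : S)) := by rw [map_sub, map_natCast]
      rw [this, hmem]
      exact hd
  obtain ⟨P₁, hP₁⟩ := exists_conj_residual_covering_of_frobCharpoly_congr h𝔪 p hp ρO W hsurj T hT hfrobO
  -- transport back along `e.symm`
  have hcomp : e.symm.toRingHom.comp e.toRingHom = RingHom.id _ := RingEquiv.symm_toRingHom_comp_toRingHom e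
  have hcomp' : e.toRingHom.comp e.symm.toRingHom = RingHom.id _ := RingEquiv.toRingHom_comp_symm_toRingHom e
  have hback : ∀ x : GL (Fin 2) O,
      Matrix.GeneralLinearGroup.map e.toRingHom (Matrix.GeneralLinearGroup.map e.symm.toRingHom x) = x := by
    intro x
    rw [generalLinearGroup_map_map e.symm.toRingHom e.toRingHom, hcomp', Matrix.GeneralLinearGroup.map_id,
      MonoidHom.id_apply]
  refine ⟨Matrix.GeneralLinearGroup.map e.symm.toRingHom P₁, fun q ↦ ?_⟩
  obtain ⟨γ, hγ⟩ := hP₁ q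
  refine ⟨γ, fun i j ↦ ?_⟩
  -- `e` maps `P₀ ρ γ P₀⁻¹` to `P₁ ρO γ P₁⁻¹`
  have hmap : Matrix.GeneralLinearGroup.map e.toRingHom
      (Matrix.GeneralLinearGroup.map e.symm.toRingHom P₁ * ρ γ * (Matrix.GeneralLinearGroup.map e.symm.toRingHom P₁)⁻¹) =
      P₁ * ρO γ * P₁⁻¹ := by
    rw [map_mul, map_mul, map_inv, hback]
    rfl
  have hentry : e ((Matrix.GeneralLinearGroup.map e.symm.toRingHom P₁ * ρ γ *
      (Matrix.GeneralLinearGroup.map e.symm.toRingHom P₁)⁻¹).val i j) = (P₁ * ρO γ * P₁⁻¹).val i j :=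
    (generalLinearGroup_map_eq_iff e.toRingHom _ _).mp hmap i j
  rw [← hmem, map_sub, map_natCast, hentry]
  exact hγ i j

end unitBall

/-! ## §3 The integral ordinary newform datum `Δ : OrdinaryNewformDatum g p ι` -/

section newformDatum

variable {M : ℕ} [NeZero M] {k' : ℤ} {g' : CuspForm (Gamma0 M) k'} (p : ℕ) [Fact p.Prime]
  (ι' : coeffField g' →+* PadicAlgCl p)

/-- `ℓ^{1+(p−1)t} − ℓ` has `p`-adic norm `< 1` for a prime `ℓ ≠ p` (Fermat). [folklore] -/
theorem norm_natCast_pow_sub_natCast_lt_one {ℓ : ℕ} (hℓ : ℓ.Prime) (hℓp : ℓ ≠ p) (t : ℕ) :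
    ‖((ℓ : PadicAlgCl p) ^ (1 + (p - 1) * t) - (ℓ : PadicAlgCl p))‖ < 1 := by
  have hpp : p.Prime := Fact.out
  -- `p ∣ ℓ^{1+(p-1)t} − ℓ` in `ℤ`
  have hcop : IsCoprime (ℓ : ℤ) p := by
    rw [Nat.isCoprime_iff_coprime]
    exact (Nat.coprime_primes hℓ hpp).mpr hℓp
  have hF : (ℓ : ℤ) ^ (p - 1) ≡ 1 [ZMOD p] := Int.ModEq.pow_card_sub_one_eq_one hpp hcop
  have hF' : (ℓ : ℤ) ^ (1 + (p - 1) * t) ≡ ℓ [ZMOD p] := by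
    have h1 : ((ℓ : ℤ) ^ (p - 1)) ^ t ≡ 1 ^ t [ZMOD p] := hF.pow t
    rw [one_pow] at h1
    have h2 := h1.mul_left (ℓ : ℤ)
    rw [mul_one, ← pow_mul, ← pow_succ'] at h2
    simpa [Nat.add_comm] using h2
  obtain ⟨N, hN⟩ := (Int.ModEq.dvd hF'.symm)
  -- `ℓ^{…} − ℓ = p · N`, of norm `|p| · |N| < 1`
  have hcast : ((ℓ : PadicAlgCl p) ^ (1 + (p - 1) * t) - (ℓ : PadicAlgCl p)) =
      algebraMap ℚ_[p] (PadicAlgCl p) ((p : ℚ_[p]) * (N : ℚ_[p])) := by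
    have h1 : (((ℓ : ℤ) ^ (1 + (p - 1) * t) - (ℓ : ℤ) : ℤ) : PadicAlgCl p) =
        (ℓ : PadicAlgCl p) ^ (1 + (p - 1) * t) - (ℓ : PadicAlgCl p) := by push_cast; ring
    rw [map_mul, map_natCast, map_intCast, ← h1, hN]
    push_cast
    ring
  rw [hcast, norm_algebraMap', norm_mul]
  calc ‖(p : ℚ_[p])‖ * ‖(N : ℚ_[p])‖ ≤ ‖(p : ℚ_[p])‖ * 1 := by
        gcongr
        exact Padic.norm_int_le_one N
    _ < 1 := by rw [mul_one]; exact Padic.norm_p_lt_one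

/-- **The residual covering of a conjugate of `Δ.ρ` from a trace congruence with `W`** — the binder `hres` of
seat g17's XXII `exists_latticeClause_of_conj_residual_covering_newformDatum`, PROVED.  Let
`Δ : OrdinaryNewformDatum g p ι` (`g ∈ S_k(Γ₀(M))`, `M ≠ 0`, `(k − 1).toNat = 1 + (p − 1)t`, i.e. `k ≥ 2`,
`k ≡ 2 (mod p − 1)`), `W/ℚ` elliptic in global minimal form with `ρ̄_{W,p}` onto, and suppose
`|ι(a_ℓ(g)) − a_ℓ(W)|_p < 1` at every good prime `ℓ ∤ pM` off a finite set `T`.  Then some `P₀ ∈ GL₂(𝒪)`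
(`𝒪 = padicCoeffIntegers ι`) has, for every `q ∈ GL₂(𝔽_p)`, a `γ ∈ Γ_ℚ` with `|(P₀ Δ.ρ(γ) P₀⁻¹)_{ij} − q_{ij}|_p < 1`.
[cite: EmertonPollackWeston2006, §3.1 (p. 17)] [cite: DarmonDiamondTaylor1995, Thm. 2.3, Prop. 2.6 (b) (PDF pp. 52–54)] -/
theorem exists_conj_residual_covering_newformDatum (Δ : OrdinaryNewformDatum g' p ι')
    (hk : ∃ t : ℕ, (k' - 1).toNat = 1 + (p - 1) * t)
    (W : WeierstrassCurve ℚ) [W.IsElliptic] [W.IsGloballyMinimal] (hsurj : W.HasSurjectiveModNGaloisRep p)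
    (T : Set ℕ) (hT : T.Finite)
    (hcong : ∀ (ℓ : ℕ) [Fact ℓ.Prime], ℓ ∉ T → ¬ ℓ ∣ M → ℓ ≠ p → W.HasGoodReductionAtPrime ℓ →
      ‖ι' ⟨(qExpansion 1 ⇑g').coeff ℓ, coeff_mem_coeffField g' ℓ⟩ - (W.frobeniusTrace ℓ : PadicAlgCl p)‖ < 1) :
    ∃ P₀ : GL (Fin 2) (padicCoeffIntegers ι'), ∀ q : GL (Fin 2) (ZMod p), ∃ γ : absoluteGaloisGroup ℚ, ∀ i j,
      ‖padicCoeffIntegers.toPadicAlgCl ι' ((P₀ * Δ.ρ γ * P₀⁻¹).val i j - ((q.val i j).val : ℕ))‖ < 1 := by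
  obtain ⟨t, ht⟩ := hk
  have hM : M ≠ 0 := NeZero.ne M
  -- the finite set of places above `T ∪ {ℓ ∣ M}`
  let Tn : Set ℕ := T ∪ {ℓ | ℓ ∣ M}
  have hTn : Tn.Finite := hT.union ((Set.finite_le_nat M).subset fun ℓ hℓ ↦ Nat.le_of_dvd (Nat.pos_of_ne_zero hM) hℓ)
  let T' : Set (HeightOneSpectrum (𝓞 ℚ)) :=
    ⋃ ℓ ∈ {ℓ ∈ Tn | ℓ ≠ 0}, {v : HeightOneSpectrum (𝓞 ℚ) | (ℓ : 𝓞 ℚ) ∈ v.asIdeal}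
  have hT' : T'.Finite := finite_setOf_place_over Tn hTn
  have hinj : Function.Injective (padicCoeffIntegers.toPadicAlgCl ι') := by
    intro x y hxy
    have h1 : ((x : padicCoeffField ι') : PadicAlgCl p) = ((y : padicCoeffField ι') : PadicAlgCl p) := by
      simpa [padicCoeffIntegers.toPadicAlgCl_apply] using hxy
    exact Subtype.ext (Subtype.ext h1)
  refine exists_conj_residual_covering_unitBallSubring p (padicCoeffField ι') (padicCoeffIntegers ι')
    (mem_padicCoeffIntegers_iff ι') Δ.ρ.toMonoidHom (map_continuous Δ.ρ) W hsurj T' hT' ?_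
  intro v hv ℓ _ hℓv hℓp hgood
  have hℓ : ℓ.Prime := Fact.out
  have hℓTn : ℓ ∉ Tn := fun hmem ↦ hv (Set.mem_biUnion (x := ℓ) ⟨hmem, hℓ.ne_zero⟩ hℓv)
  have hℓT : ℓ ∉ T := fun h ↦ hℓTn (Or.inl h)
  have hℓM : ¬ ℓ ∣ M := fun h ↦ hℓTn (Or.inr h)
  have hvℓ : (Rat.HeightOneSpectrum.primesEquiv v : ℕ) = ℓ := primesEquiv_eq_of_natCast_mem hℓ hℓv
  -- the datum's Frobenius characteristic polynomial at `v`
  obtain ⟨-, P, hPmap, hP⟩ := Δ.charpoly v (by rw [hvℓ]; exact hℓM) (by rw [hvℓ]; exact hℓp)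
  rw [hvℓ] at hPmap
  obtain ⟨c, d, hPcd, hc, hd⟩ := exists_quadratic_of_map_eq _ hinj hPmap
  refine ⟨c, d, fun 𝔓 h𝔓 Φ hΦ ↦ ?_, ?_, ?_⟩
  · have := hP 𝔓 h𝔓 Φ hΦ
    rw [hPcd] at this
    exact this
  · -- `|ι(a_ℓ(g)) − a_ℓ(W)| < 1`
    have e1 : ‖(((c - ((W.frobeniusTrace ℓ : ℤ) : padicCoeffIntegers ι') : padicCoeffIntegers ι') :
        padicCoeffField ι') : PadicAlgCl p)‖ =
        ‖padicCoeffIntegers.toPadicAlgCl ι' c - (W.frobeniusTrace ℓ : PadicAlgCl p)‖ := by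
      rw [← padicCoeffIntegers.toPadicAlgCl_apply, map_sub, map_intCast]
    show ‖(((c - ((W.frobeniusTrace ℓ : ℤ) : padicCoeffIntegers ι') : padicCoeffIntegers ι') :
        padicCoeffField ι') : PadicAlgCl p)‖ < 1
    rw [e1, hc]
    exact hcong ℓ hℓT hℓM hℓp hgood
  · -- `|ℓ^{k−1} − ℓ| < 1`
    have hdℓ : d = (ℓ : padicCoeffIntegers ι') ^ (k' - 1).toNat := by
      apply hinj
      rw [hd, map_pow, map_natCast]
    have e1 : ‖(((d - (ℓ : padicCoeffIntegers ι') : padicCoeffIntegers ι') : padicCoeffField ι') : PadicAlgCl p)‖ =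
        ‖((ℓ : PadicAlgCl p) ^ (1 + (p - 1) * t) - (ℓ : PadicAlgCl p))‖ := by
      rw [← padicCoeffIntegers.toPadicAlgCl_apply, map_sub, hdℓ, map_pow, map_natCast, ht]
    show ‖(((d - (ℓ : padicCoeffIntegers ι') : padicCoeffIntegers ι') : padicCoeffField ι') : PadicAlgCl p)‖ < 1
    rw [e1]
    exact norm_natCast_pow_sub_natCast_lt_one p hℓ hℓp t

end newformDatum

/-! ## §4 END FORM at `p = 5`: the desk's T1 `LatticeClause Δ` from the trace congruence, by kernel -/

section endForm

variable {M : ℕ} [NeZero M] {k' : ℤ} {g' : CuspForm (Gamma0 M) k'} [Fact (Nat.Prime 5)]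
  (ι' : coeffField g' →+* PadicAlgCl 5)

/-- **T1 `LatticeClause Δ` BY KERNEL from the datum, `K_g` a number field, `Surj W 5` and the trace congruence** (seat
g17's XXII `exists_latticeClause_of_conj_residual_covering_newformDatum` fed with §3): for `Δ : OrdinaryNewformDatum g 5 ι`
(`g ∈ S_k(Γ₀(M))`, `M ≠ 0`, `(k − 1).toNat = 1 + 4t`, `K_g/ℚ` finite — the named-print shape
`IsNewform0.finiteDimensional_coeffField`, Shimura 3.48), `W/ℚ` elliptic in global minimal form with `ρ̄_{W,5}` onto and
`|ι(a_ℓ(g)) − a_ℓ(W)|₅ < 1` at the good `ℓ ∤ 5M` off a finite set, there is `P ∈ GL₂(𝒪)` such that every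
`A ∈ SL₂(ℤ₅)` is `P Δ.ρ(σ) P⁻¹` (read in `ℚ̄₅`) for some `σ ∈ Γ_ℚ` fixing every root of unity — Kato's (12.5.2) for
the member `g` of the ordinary fibre through `ρ̄_{W,5}`. [cite: Kato2004Asterisque, §12 (12.5.2) and Thm. 14.5]
[cite: EmertonPollackWeston2006, §3.1 (p. 17)] [cite: Shimura1971, Thm. 3.48] -/
theorem exists_latticeClause_newformDatum_of_traceCongruent [FiniteDimensional ℚ (coeffField g')]
    (Δ : OrdinaryNewformDatum g' 5 ι') (hk : ∃ t : ℕ, (k' - 1).toNat = 1 + 4 * t)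
    (W : WeierstrassCurve ℚ) [W.IsElliptic] [W.IsGloballyMinimal] (hsurj : W.HasSurjectiveModNGaloisRep 5)
    (T : Set ℕ) (hT : T.Finite)
    (hcong : ∀ (ℓ : ℕ) [Fact ℓ.Prime], ℓ ∉ T → ¬ ℓ ∣ M → ℓ ≠ 5 → W.HasGoodReductionAtPrime ℓ →
      ‖ι' ⟨(qExpansion 1 ⇑g').coeff ℓ, coeff_mem_coeffField g' ℓ⟩ - (W.frobeniusTrace ℓ : PadicAlgCl 5)‖ < 1) :
    ∃ P : GL (Fin 2) (padicCoeffIntegers ι'), ∀ A : SL(2, ℤ_[5]), ∃ σ : absoluteGaloisGroup ℚ,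
      (∀ (k : ℕ) (t : AlgebraicClosure ℚ), 0 < k → t ^ k = 1 → σ • t = t) ∧
        ((P * Δ.ρ σ * P⁻¹ : GL (Fin 2) (padicCoeffIntegers ι')) :
            Matrix (Fin 2) (Fin 2) (padicCoeffIntegers ι')).map (padicCoeffIntegers.toPadicAlgCl ι') =
          (A : Matrix (Fin 2) (Fin 2) ℤ_[5]).map ((algebraMap ℚ_[5] (PadicAlgCl 5)).comp PadicInt.Coe.ringHom) :=
  exists_latticeClause_of_conj_residual_covering_newformDatum ι' Δ
    (exists_conj_residual_covering_newformDatum 5 ι' Δ (by simpa using hk) W hsurj T hT hcong)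

/-- The same with **`K = ℚ₅(ι K_g)` finite over `ℚ₅`** displayed instead of `K_g` a number field (XXII
`exists_latticeClause_of_conj_residual_covering_unitBallSubring` for the unit-ball subring `𝒪 = padicCoeffIntegers ι` of
`K = padicCoeffField ι`). [cite: Kato2004Asterisque, §12 (12.5.2) and Thm. 14.5] [cite: EmertonPollackWeston2006, §3.1 (p. 17)] -/
theorem exists_latticeClause_newformDatum_of_traceCongruent_of_finiteDimensional_padicCoeffField
    [FiniteDimensional ℚ_[5] (padicCoeffField ι')]
    (Δ : OrdinaryNewformDatum g' 5 ι') (hk : ∃ t : ℕ, (k' - 1).toNat = 1 + 4 * t)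
    (W : WeierstrassCurve ℚ) [W.IsElliptic] [W.IsGloballyMinimal] (hsurj : W.HasSurjectiveModNGaloisRep 5)
    (T : Set ℕ) (hT : T.Finite)
    (hcong : ∀ (ℓ : ℕ) [Fact ℓ.Prime], ℓ ∉ T → ¬ ℓ ∣ M → ℓ ≠ 5 → W.HasGoodReductionAtPrime ℓ →
      ‖ι' ⟨(qExpansion 1 ⇑g').coeff ℓ, coeff_mem_coeffField g' ℓ⟩ - (W.frobeniusTrace ℓ : PadicAlgCl 5)‖ < 1) :
    ∃ P : GL (Fin 2) (padicCoeffIntegers ι'), ∀ A : SL(2, ℤ_[5]), ∃ σ : absoluteGaloisGroup ℚ,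
      (∀ (k : ℕ) (t : AlgebraicClosure ℚ), 0 < k → t ^ k = 1 → σ • t = t) ∧
        ((P * Δ.ρ σ * P⁻¹ : GL (Fin 2) (padicCoeffIntegers ι')) :
            Matrix (Fin 2) (Fin 2) (padicCoeffIntegers ι')).map (padicCoeffIntegers.toPadicAlgCl ι') =
          (A : Matrix (Fin 2) (Fin 2) ℤ_[5]).map ((algebraMap ℚ_[5] (PadicAlgCl 5)).comp PadicInt.Coe.ringHom) := by
  obtain ⟨P₀, hP₀⟩ := exists_conj_residual_covering_newformDatum 5 ι' Δ (by simpa using hk) W hsurj T hT hcong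
  have hres : ∃ P₀ : GL (Fin 2) (padicCoeffIntegers ι'), ∀ q : GL (Fin 2) (ZMod 5), ∃ γ : absoluteGaloisGroup ℚ,
      ∀ i j, ‖((((P₀ * Δ.ρ.toMonoidHom γ * P₀⁻¹).val i j - ((q.val i j).val : ℕ) : padicCoeffIntegers ι') :
        padicCoeffField ι') : PadicAlgCl 5)‖ < 1 := by
    refine ⟨P₀, fun q ↦ ?_⟩
    obtain ⟨γ, hγ⟩ := hP₀ q
    refine ⟨γ, fun i j ↦ ?_⟩
    have h := hγ i j
    rw [padicCoeffIntegers.toPadicAlgCl_apply] at h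
    exact h
  obtain ⟨P, hP⟩ := exists_latticeClause_of_conj_residual_covering_unitBallSubring ℚ (padicCoeffField ι')
    (padicCoeffIntegers ι') (mem_padicCoeffIntegers_iff ι') Δ.ρ.toMonoidHom (map_continuous Δ.ρ) hres
  refine ⟨P, fun A ↦ ?_⟩
  obtain ⟨σ, hσ, hσA⟩ := hP A
  refine ⟨σ, hσ, ?_⟩
  have hfun : (padicCoeffIntegers.toPadicAlgCl ι' : padicCoeffIntegers ι' → PadicAlgCl 5) =
      fun x : padicCoeffIntegers ι' ↦ (((x : padicCoeffIntegers ι') : padicCoeffField ι') : PadicAlgCl 5) :=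
    funext fun x ↦ padicCoeffIntegers.toPadicAlgCl_apply ι' x
  rw [hfun]
  exact hσA

end endForm

end Summit.BirchSwinnertonDyer.BirchSwinnertonDyer.Theorems.FibreResidualIdentification

end
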